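import Mathlib
import Literature.MathematicalPhysics.StatisticalMechanics.Crystallization
import Literature.MathematicalPhysics.StatisticalMechanics.LennardJonesClusters
import Summits.AtomisticToContinuum.Crystallization.Theorems.ThreeConeCertificateExactCertificateTransfer1DSlack
import Summits.AtomisticToContinuum.Crystallization.Theorems.ThreeConeCertificateExactCertificateTransfer1DClassMie
import Summits.AtomisticToContinuum.Crystallization.Theorems.ThreeConeCertificateExactCertificateTransfer1DUniqueBlock
import Summits.AtomisticToContinuum.Crystallization.Theorems.ThreeConeCertificateExactCertificateTransfer1DUniqueBlockEnergy
import Summits.AtomisticToContinuum.Crystallization.Theorems.ThreeConeCertificateExactCertificateTransfer1DUniqueCovariance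
import Summits.AtomisticToContinuum.Crystallization.Theorems.ThreeConeCertificateExactCertificateTransfer1DUniqueCongruence
import Summits.AtomisticToContinuum.Crystallization.Theorems.ThreeConeCertificateExactCertificateTransfer1DUniqueIsometryChain

/-!
# Crux `ExactCertificate` (stmt-AtomisticToContinuum-11959), line `closure-makes-nogap-exact`:
# TRANSFER VI — UNIQUENESS OF THE PERIODIC GROUND STATE OF THE LENNARD-JONES CHAIN

Support file (`--supports stmt-AtomisticToContinuum-11959`); nothing here closes the 3-D crux, which stays
`NoGap ∧ KeplerBound` with `KeplerBound` = item 11961 ↔ 0627 (open).  Assembly of Transfer skeleton VI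
(`Cruxes/ExactCertificate/Lines/closure_makes_nogap_exact_unique1d.lean`, deciding decl `UniquePeriodicMinimiser1D`),
composing its five landed stubs (`stub_block1D` p157383, `stub_blockEnergy1D` p157282, `stub_badOfBadSite1D` p157135,
`stub_exactOfGood1D` p157163, `stub_isometryChain1D` p157203) with c8's rate theorem
`slackRigidityRate_lennardJones_one` and Transfer V's explicit zero-pressure chain (`mie_oneCrossingData`,
`oneCrossing_magic`, `energyPerParticle_ge_of_oneCrossing`, `keplerBound_one_of_oneCrossing`).

## Statement (`uniquePeriodicMinimiser_lennardJones_one` = registered `stub_uniqueAssembly`)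

There is `a > 0` (the zero-pressure spacing, `a⁶ = ζ(12)/ζ(6)`) such that (i) a periodic configuration of `ℝ¹` with point set
`{(ka)e₀ : k ∈ ℤ}` MINIMISES the Lennard-Jones energy per particle over all periodic configurations of the line (existence:
c6 / Transfer V), and (ii) EVERY periodic minimiser `Q` is a TRANSLATE of it: `Q.points = {q + (ka)e₀ : k ∈ ℤ}` for each of its
points `q`.  In d = 3 the corresponding statement ("the thesis pins every periodic minimiser to ONE isometry class") is a tree
theorem CONDITIONAL on the crux `SlackRigidity` (`ThreeConeCertificateSlackRigidityPinsMinimisers`, `…LawPalmSplit`); here it is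
unconditional, by the same mechanism with every input a d = 1 theorem.

## Mechanism

Let `Q` be a periodic minimiser and `q₀ ∈ Q.points`.  If `q₀` were NOT two-way `(R, ε)`-matched to the rate theorem's template
`P`, then in the block of `K` cells of `Q` (`#F·K` points, `stub_block1D`) the `≥ K − D` deep points congruent to `q₀` would all be
bad (`stub_badOfBadSite1D`), while `#bad ≤ A + B·(E(block) − E(#F K))` (`slackRigidityRate_lennardJones_one`) with
`E(block) = #F K e(Q) + o(K)` (`stub_blockEnergy1D`) and `E(#F K) ≥ #F K e(Q)` (the sharp Kepler bound at the explicit chain, which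
is a periodic minimiser, so `e(Q) = e(aℤ)`) — a contradiction for large `K`.  So every site of `Q` is matched to `P` at every scale,
hence `Q.points = q₀ + A(P.points)` exactly (`stub_exactOfGood1D`); running this on the explicit chain identifies `P.points = aℤe₀`
up to sign, and isometric images of a chain are translated chains (`stub_isometryChain1D`).  Corollaries: any two periodic
minimisers are translates of each other (`periodicMinimisers_translate`); the nearest-neighbour spacing of a periodic minimiser is
forced (`a` is unique: `zeroPressureSpacing_unique`).  All `[folklore]` (Ventevogel 1978 proves minimality of the equidistant
configuration among periodic ones by convexity; the rigidity route here is the route's own).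
-/

noncomputable section

namespace Summit.AtomisticToContinuum.Crystallization.Theorems.ThreeConeCertificateExactCertificate.Transfer1D

open Literature.MathematicalPhysics.StatisticalMechanics MeasureTheory Set Filter Topology
open scoped BigOperators

/-- **UNIQUENESS OF THE PERIODIC LENNARD-JONES GROUND STATE OF THE LINE** (the deciding statement `UniquePeriodicMinimiser1D` of
Transfer skeleton VI): there is `a > 0` such that some periodic configuration with point set `{(ka)e₀}` minimises the Lennard-Jones
energy per particle over all periodic configurations of `ℝ¹`, and every periodic minimiser `Q` satisfies
`Q.points = {q + (ka)e₀ : k ∈ ℤ}` for each `q ∈ Q.points`. [folklore] -/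
theorem uniquePeriodicMinimiser_lennardJones_one :
    ∃ a : ℝ, 0 < a ∧
    (∃ P₀ : PeriodicConfiguration 1,
      P₀.points = Set.range (fun k : ℤ => EuclideanSpace.single (0 : Fin 1) ((k : ℝ) * a)) ∧
      ∀ Q : PeriodicConfiguration 1, P₀.energyPerParticle lennardJones ≤ Q.energyPerParticle lennardJones) ∧
    ∀ Q : PeriodicConfiguration 1,
      (∀ Q' : PeriodicConfiguration 1, Q.energyPerParticle lennardJones ≤ Q'.energyPerParticle lennardJones) →
      ∀ q ∈ Q.points, Q.points = Set.range (fun k : ℤ => q + EuclideanSpace.single (0 : Fin 1) ((k : ℝ) * a)) := by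
  -- (0) the explicit zero-pressure chain of Transfer V (Lennard-Jones = Mie (12,6))
  have hLJ : Literature.Barriers.AtomisticToContinuum.mieWith (1 / 12) (1 / 6) 12 6 = lennardJones :=
    (Literature.Barriers.AtomisticToContinuum.lennardJones_eq_lennardJonesWith.trans
      (Literature.Barriers.AtomisticToContinuum.lennardJonesWith_eq_mieWith _ _)).symm
  obtain ⟨p, t₀, C, a, M, hpm, ht₀, hpos, hneg, hM, hbd, hV, ha, hz⟩ :=
    mie_oneCrossingData (A := 1 / 12) (B := 1 / 6) (n := 12) (m := 6)
      (by norm_num) (by norm_num) (by norm_num) (by norm_num)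
  rw [hLJ] at hV
  obtain ⟨f, Pa, e, he, hPa, -, -, -, -⟩ := oneCrossing_magic hpm ht₀ hpos hneg hM hbd hV ha hz
  have hmin : ∀ Q : PeriodicConfiguration 1,
      Pa.energyPerParticle lennardJones ≤ Q.energyPerParticle lennardJones :=
    fun Q => hPa ▸ energyPerParticle_ge_of_oneCrossing hpm ht₀ hpos hneg hM hbd hV ha hz Q
  have hkep : ∀ (N : ℕ) (x : Fin N → EuclideanSpace ℝ (Fin 1)), Function.Injective x →
      (N : ℝ) * Pa.energyPerParticle lennardJones ≤ interactionEnergy lennardJones x :=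
    fun N x hx => hPa ▸ keplerBound_one_of_oneCrossing hpm ht₀ hpos hneg hM hbd hV ha hz N x hx
  have hPapts : Pa.points = Set.range (fun k : ℤ => EuclideanSpace.single (0 : Fin 1) ((k : ℝ) * a)) := by
    ext z
    constructor
    · intro hz'
      obtain ⟨k, hk⟩ := e.surjective ⟨z, hz'⟩
      refine ⟨k, ?_⟩
      show EuclideanSpace.single (0 : Fin 1) ((k : ℝ) * a) = z
      rw [← he k, hk]
    · rintro ⟨k, rfl⟩
      show EuclideanSpace.single (0 : Fin 1) ((k : ℝ) * a) ∈ Pa.points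
      rw [← he k]
      exact (e k).2
  -- (1) the rate theorem's (hidden) template `Pr`
  obtain ⟨Pr, hPr⟩ := slackRigidityRate_lennardJones_one
  -- (2) KEY: every site of every periodic minimiser is two-way matched to `Pr` at every scale
  have key : ∀ Q : PeriodicConfiguration 1,
      (∀ Q' : PeriodicConfiguration 1, Q.energyPerParticle lennardJones ≤ Q'.energyPerParticle lennardJones) →
      ∀ q₀ ∈ Q.points, ∀ R ε : ℝ, 0 < R → 0 < ε →
      ∃ A : EuclideanSpace ℝ (Fin 1) →ₗᵢ[ℝ] EuclideanSpace ℝ (Fin 1),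
        (∀ p ∈ Pr.points, ‖p‖ ≤ R → ∃ z ∈ Q.points, dist z (q₀ + A p) ≤ ε) ∧
        (∀ z ∈ Q.points, dist z q₀ ≤ R → ∃ p ∈ Pr.points, dist z (q₀ + A p) ≤ ε) := by
    intro Q hQ q₀ hq₀ R ε hR hε
    by_contra hbad
    obtain ⟨v, -, hv⟩ := stub_latticeGenerator1D Q
    obtain ⟨hinj, hmem, hdeep⟩ := stub_block1D Q v hv
    obtain ⟨D, hD⟩ := hdeep R hR
    have hEt := stub_blockEnergy1D Q v hv
    obtain ⟨A, B, hA0, hB0, hrate⟩ := hPr R ε hR hε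
    have heq : Q.energyPerParticle lennardJones = Pa.energyPerParticle lennardJones :=
      le_antisymm (hQ Pa) (hmin Q)
    -- for every `K`: `K − D ≤ A + B·s_K`, `s_K` the block's energy excess over `N e(Q)`
    have hK : ∀ K : ℕ, (K : ℝ) - D ≤ A + B *
        (interactionEnergy lennardJones (fun i : Fin (Q.motif.card * K) => (((Q.motif.equivFin.symm (finProdFinEquiv.symm i).1 : Q.motif) : EuclideanSpace ℝ (Fin 1)) + (((finProdFinEquiv.symm i).2 : ℕ) : ℝ) • v))
          - ((Q.motif.card * K : ℕ) : ℝ) * Q.energyPerParticle lennardJones) := by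
      intro K
      have h1 := hD K q₀ hq₀
      have h2 := hrate (Q.motif.card * K) (fun i : Fin (Q.motif.card * K) => (((Q.motif.equivFin.symm (finProdFinEquiv.symm i).1 : Q.motif) : EuclideanSpace ℝ (Fin 1)) + (((finProdFinEquiv.symm i).2 : ℕ) : ℝ) • v)) (hinj K)
      -- deep & congruent ⟹ bad
      have h3 : Nat.card {i : Fin (Q.motif.card * K) //
            (((Q.motif.equivFin.symm (finProdFinEquiv.symm i).1 : Q.motif) : EuclideanSpace ℝ (Fin 1)) + (((finProdFinEquiv.symm i).2 : ℕ) : ℝ) • v) - q₀ ∈ Q.lattice ∧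
            ∀ z ∈ Q.points, dist z ((((Q.motif.equivFin.symm (finProdFinEquiv.symm i).1 : Q.motif) : EuclideanSpace ℝ (Fin 1)) + (((finProdFinEquiv.symm i).2 : ℕ) : ℝ) • v)) ≤ R →
              ∃ j : Fin (Q.motif.card * K), (((Q.motif.equivFin.symm (finProdFinEquiv.symm j).1 : Q.motif) : EuclideanSpace ℝ (Fin 1)) + (((finProdFinEquiv.symm j).2 : ℕ) : ℝ) • v) = z} ≤
          Nat.card {i : Fin (Q.motif.card * K) // ¬ ∃ A : EuclideanSpace ℝ (Fin 1) →ₗᵢ[ℝ] EuclideanSpace ℝ (Fin 1),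
            (∀ p ∈ Pr.points, ‖p‖ ≤ R → ∃ j : Fin (Q.motif.card * K),
              dist ((fun i : Fin (Q.motif.card * K) => (((Q.motif.equivFin.symm (finProdFinEquiv.symm i).1 : Q.motif) : EuclideanSpace ℝ (Fin 1)) + (((finProdFinEquiv.symm i).2 : ℕ) : ℝ) • v)) j)
                ((fun i : Fin (Q.motif.card * K) => (((Q.motif.equivFin.symm (finProdFinEquiv.symm i).1 : Q.motif) : EuclideanSpace ℝ (Fin 1)) + (((finProdFinEquiv.symm i).2 : ℕ) : ℝ) • v)) i + A p) ≤ ε) ∧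
            (∀ j : Fin (Q.motif.card * K),
              dist ((fun i : Fin (Q.motif.card * K) => (((Q.motif.equivFin.symm (finProdFinEquiv.symm i).1 : Q.motif) : EuclideanSpace ℝ (Fin 1)) + (((finProdFinEquiv.symm i).2 : ℕ) : ℝ) • v)) j)
                ((fun i : Fin (Q.motif.card * K) => (((Q.motif.equivFin.symm (finProdFinEquiv.symm i).1 : Q.motif) : EuclideanSpace ℝ (Fin 1)) + (((finProdFinEquiv.symm i).2 : ℕ) : ℝ) • v)) i) ≤ R →
              ∃ p ∈ Pr.points, dist ((fun i : Fin (Q.motif.card * K) => (((Q.motif.equivFin.symm (finProdFinEquiv.symm i).1 : Q.motif) : EuclideanSpace ℝ (Fin 1)) + (((finProdFinEquiv.symm i).2 : ℕ) : ℝ) • v)) j)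
                ((fun i : Fin (Q.motif.card * K) => (((Q.motif.equivFin.symm (finProdFinEquiv.symm i).1 : Q.motif) : EuclideanSpace ℝ (Fin 1)) + (((finProdFinEquiv.symm i).2 : ℕ) : ℝ) • v)) i + A p) ≤ ε)} := by
        refine Nat.card_le_card_of_injective
          (fun u => ⟨u.1, stub_badOfBadSite1D Pr Q R ε (Q.motif.card * K)
            (fun i : Fin (Q.motif.card * K) => (((Q.motif.equivFin.symm (finProdFinEquiv.symm i).1 : Q.motif) : EuclideanSpace ℝ (Fin 1)) + (((finProdFinEquiv.symm i).2 : ℕ) : ℝ) • v)) (hmem K) q₀ hq₀ hbad u.1 u.2⟩) ?_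
        intro u u' h
        simp only [Subtype.mk.injEq] at h
        exact Subtype.ext h
      -- `E(N) ≥ N e(Q)` (Kepler at the explicit chain, `e(Q) = e(Pa)`)
      have h4 : ((Q.motif.card * K : ℕ) : ℝ) * Q.energyPerParticle lennardJones ≤
          groundStateEnergy lennardJones 1 (Q.motif.card * K) := by
        rw [heq]
        haveI : Nonempty {x : Fin (Q.motif.card * K) → EuclideanSpace ℝ (Fin 1) // Function.Injective x} := ⟨⟨_, hinj K⟩⟩
        exact le_ciInf fun y => hkep _ y.1 y.2
      have h3' : (Nat.card {i : Fin (Q.motif.card * K) //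
            (((Q.motif.equivFin.symm (finProdFinEquiv.symm i).1 : Q.motif) : EuclideanSpace ℝ (Fin 1)) + (((finProdFinEquiv.symm i).2 : ℕ) : ℝ) • v) - q₀ ∈ Q.lattice ∧
            ∀ z ∈ Q.points, dist z ((((Q.motif.equivFin.symm (finProdFinEquiv.symm i).1 : Q.motif) : EuclideanSpace ℝ (Fin 1)) + (((finProdFinEquiv.symm i).2 : ℕ) : ℝ) • v)) ≤ R →
              ∃ j : Fin (Q.motif.card * K), (((Q.motif.equivFin.symm (finProdFinEquiv.symm j).1 : Q.motif) : EuclideanSpace ℝ (Fin 1)) + (((finProdFinEquiv.symm j).2 : ℕ) : ℝ) • v) = z} : ℝ) ≤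
          Nat.card {i : Fin (Q.motif.card * K) // ¬ ∃ A : EuclideanSpace ℝ (Fin 1) →ₗᵢ[ℝ] EuclideanSpace ℝ (Fin 1),
            (∀ p ∈ Pr.points, ‖p‖ ≤ R → ∃ j : Fin (Q.motif.card * K),
              dist ((fun i : Fin (Q.motif.card * K) => (((Q.motif.equivFin.symm (finProdFinEquiv.symm i).1 : Q.motif) : EuclideanSpace ℝ (Fin 1)) + (((finProdFinEquiv.symm i).2 : ℕ) : ℝ) • v)) j)
                ((fun i : Fin (Q.motif.card * K) => (((Q.motif.equivFin.symm (finProdFinEquiv.symm i).1 : Q.motif) : EuclideanSpace ℝ (Fin 1)) + (((finProdFinEquiv.symm i).2 : ℕ) : ℝ) • v)) i + A p) ≤ ε) ∧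
            (∀ j : Fin (Q.motif.card * K),
              dist ((fun i : Fin (Q.motif.card * K) => (((Q.motif.equivFin.symm (finProdFinEquiv.symm i).1 : Q.motif) : EuclideanSpace ℝ (Fin 1)) + (((finProdFinEquiv.symm i).2 : ℕ) : ℝ) • v)) j)
                ((fun i : Fin (Q.motif.card * K) => (((Q.motif.equivFin.symm (finProdFinEquiv.symm i).1 : Q.motif) : EuclideanSpace ℝ (Fin 1)) + (((finProdFinEquiv.symm i).2 : ℕ) : ℝ) • v)) i) ≤ R →
              ∃ p ∈ Pr.points, dist ((fun i : Fin (Q.motif.card * K) => (((Q.motif.equivFin.symm (finProdFinEquiv.symm i).1 : Q.motif) : EuclideanSpace ℝ (Fin 1)) + (((finProdFinEquiv.symm i).2 : ℕ) : ℝ) • v)) j)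
                ((fun i : Fin (Q.motif.card * K) => (((Q.motif.equivFin.symm (finProdFinEquiv.symm i).1 : Q.motif) : EuclideanSpace ℝ (Fin 1)) + (((finProdFinEquiv.symm i).2 : ℕ) : ℝ) • v)) i + A p) ≤ ε)} := by
        exact_mod_cast h3
      nlinarith [h1, h2, h3', h4, hB0]
    -- the limit `K → ∞`: `s_K = o(K)` contradicts `K − D ≤ A + B s_K`
    have hBpos : (0 : ℝ) < 2 * (B + 1) := by positivity
    have hev := hEt.eventually (Metric.ball_mem_nhds (0 : ℝ) (show (0 : ℝ) < 1 / (2 * (B + 1)) by positivity))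
    obtain ⟨K, hK1, hK2⟩ := (hev.and (eventually_ge_atTop (⌈2 * (A + D) + 2⌉₊ + 1))).exists
    have hKpos : (0 : ℝ) < K := by
      have : (1 : ℕ) ≤ K := le_trans (Nat.le_add_left 1 _) hK2
      exact_mod_cast this
    have hKge : 2 * (A + D) + 2 ≤ (K : ℝ) := by
      have h := Nat.le_ceil (2 * (A + D) + 2)
      have h' : ((⌈2 * (A + D) + 2⌉₊ + 1 : ℕ) : ℝ) ≤ K := by exact_mod_cast hK2
      push_cast at h'
      linarith
    rw [dist_zero_right, Real.norm_eq_abs, abs_lt] at hK1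
    have hs := hK1.2
    rw [div_lt_iff₀ hKpos] at hs
    have hKK := hK K
    -- `B s_K ≤ B K/(2(B+1)) ≤ K/2`
    have hBs : B * (interactionEnergy lennardJones (fun i : Fin (Q.motif.card * K) => (((Q.motif.equivFin.symm (finProdFinEquiv.symm i).1 : Q.motif) : EuclideanSpace ℝ (Fin 1)) + (((finProdFinEquiv.symm i).2 : ℕ) : ℝ) • v))
          - ((Q.motif.card * K : ℕ) : ℝ) * Q.energyPerParticle lennardJones) ≤ K / 2 := by
      have h1 : B * (interactionEnergy lennardJones (fun i : Fin (Q.motif.card * K) => (((Q.motif.equivFin.symm (finProdFinEquiv.symm i).1 : Q.motif) : EuclideanSpace ℝ (Fin 1)) + (((finProdFinEquiv.symm i).2 : ℕ) : ℝ) • v))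
          - ((Q.motif.card * K : ℕ) : ℝ) * Q.energyPerParticle lennardJones) ≤ B * (1 / (2 * (B + 1)) * K) :=
        mul_le_mul_of_nonneg_left hs.le hB0
      have h2 : B * (1 / (2 * (B + 1)) * K) ≤ K / 2 := by
        rw [show B * (1 / (2 * (B + 1)) * K) = (B / (B + 1)) * (K / 2) by field_simp]
        have : B / (B + 1) ≤ 1 := by rw [div_le_one (by linarith)]; linarith
        nlinarith
      linarith
    linarith
  -- (3) congruence of every minimiser to `Pr`
  have hcong : ∀ Q : PeriodicConfiguration 1,
      (∀ Q' : PeriodicConfiguration 1, Q.energyPerParticle lennardJones ≤ Q'.energyPerParticle lennardJones) →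
      ∀ q₀ ∈ Q.points, ∃ A : EuclideanSpace ℝ (Fin 1) →ₗᵢ[ℝ] EuclideanSpace ℝ (Fin 1), Q.points = (fun p => q₀ + A p) '' Pr.points :=
    fun Q hQ q₀ hq₀ => stub_exactOfGood1D Pr Q q₀ hq₀ (key Q hQ q₀ hq₀)
  -- (4) identify `Pr.points` through the explicit chain `Pa` at its site `0`
  have h0 : (0 : EuclideanSpace ℝ (Fin 1)) ∈ Pa.points := by
    rw [hPapts]
    exact ⟨0, by simp⟩
  obtain ⟨A₀, hA₀⟩ := hcong Pa hmin 0 h0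
  have hrank : Module.finrank ℝ (EuclideanSpace ℝ (Fin 1)) = Module.finrank ℝ (EuclideanSpace ℝ (Fin 1)) := rfl
  set A₀e : EuclideanSpace ℝ (Fin 1) ≃ₗᵢ[ℝ] EuclideanSpace ℝ (Fin 1) := A₀.toLinearIsometryEquiv hrank with hA₀e
  have hA₀e_apply : ∀ p, A₀e p = A₀ p := fun p => rfl
  have hPr : Pr.points = Set.range (fun k : ℤ => EuclideanSpace.single (0 : Fin 1) ((k : ℝ) * a)) := by
    -- `Pr.points = A₀⁻¹(Pa.points) = 0 + A₀⁻¹(aℤe₀) = aℤe₀`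
    have h1 : Pr.points = (fun p => (0 : EuclideanSpace ℝ (Fin 1)) + A₀e.symm.toLinearIsometry p) '' Pa.points := by
      ext p
      simp only [zero_add, Set.mem_image, LinearIsometryEquiv.coe_toLinearIsometry]
      constructor
      · intro hp
        refine ⟨A₀ p, ?_, ?_⟩
        · rw [hA₀]; exact ⟨p, hp, by simp⟩
        · rw [← hA₀e_apply, LinearIsometryEquiv.symm_apply_apply]
      · rintro ⟨z, hz, rfl⟩
        rw [hA₀] at hz
        obtain ⟨p', hp', rfl⟩ := hz
        simpa only [zero_add, ← hA₀e_apply, LinearIsometryEquiv.symm_apply_apply] using hp'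
    rw [h1, hPapts, stub_isometryChain1D a 0 A₀e.symm.toLinearIsometry]
    simp only [zero_add]
  -- (5) conclude
  refine ⟨a, ha, ⟨Pa, hPapts, hmin⟩, fun Q hQ q hq => ?_⟩
  obtain ⟨A, hAQ⟩ := hcong Q hQ q hq
  rw [hAQ, hPr, stub_isometryChain1D a q A]


/-- **Registered stub `stub_uniqueAssembly`** — the deciding statement `UniquePeriodicMinimiser1D` of Transfer skeleton VI as a
closed proposition (= `uniquePeriodicMinimiser_lennardJones_one`). [folklore] -/
theorem stub_uniqueAssembly :
    ∃ a : ℝ, 0 < a ∧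
    (∃ P₀ : PeriodicConfiguration 1,
      P₀.points = Set.range (fun k : ℤ => EuclideanSpace.single (0 : Fin 1) ((k : ℝ) * a)) ∧
      ∀ Q : PeriodicConfiguration 1, P₀.energyPerParticle lennardJones ≤ Q.energyPerParticle lennardJones) ∧
    ∀ Q : PeriodicConfiguration 1,
      (∀ Q' : PeriodicConfiguration 1, Q.energyPerParticle lennardJones ≤ Q'.energyPerParticle lennardJones) →
      ∀ q ∈ Q.points, Q.points = Set.range (fun k : ℤ => q + EuclideanSpace.single (0 : Fin 1) ((k : ℝ) * a)) :=
  uniquePeriodicMinimiser_lennardJones_one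

/-- **Any two periodic Lennard-Jones minimisers of the line are translates of each other.** [folklore] -/
theorem periodicMinimisers_translate (Q Q' : PeriodicConfiguration 1)
    (hQ : ∀ Q'' : PeriodicConfiguration 1, Q.energyPerParticle lennardJones ≤ Q''.energyPerParticle lennardJones)
    (hQ' : ∀ Q'' : PeriodicConfiguration 1, Q'.energyPerParticle lennardJones ≤ Q''.energyPerParticle lennardJones) :
    ∃ t : EuclideanSpace ℝ (Fin 1), Q'.points = (fun z => t + z) '' Q.points := by
  obtain ⟨a, -, -, huniq⟩ := uniquePeriodicMinimiser_lennardJones_one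
  obtain ⟨q, hq⟩ := Q.points_nonempty
  obtain ⟨q', hq'⟩ := Q'.points_nonempty
  have h1 := huniq Q hQ q hq
  have h2 := huniq Q' hQ' q' hq'
  refine ⟨q' - q, ?_⟩
  rw [h2, h1, ← Set.range_comp]
  refine congrArg Set.range (funext fun k => ?_)
  simp only [Function.comp]
  abel

/-- **The zero-pressure spacing is unique**: if periodic configurations with point sets `{(ka)e₀}` and `{(kb)e₀}` (`a, b > 0`) both
minimise the Lennard-Jones energy per particle over periodic configurations of the line, then `a = b` (both are translates of one
chain, whose nearest-neighbour distance is determined). [folklore] -/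
theorem zeroPressureSpacing_unique {a b : ℝ} (ha : 0 < a) (hb : 0 < b) (Pa Pb : PeriodicConfiguration 1)
    (hPa : Pa.points = Set.range (fun k : ℤ => EuclideanSpace.single (0 : Fin 1) ((k : ℝ) * a)))
    (hPb : Pb.points = Set.range (fun k : ℤ => EuclideanSpace.single (0 : Fin 1) ((k : ℝ) * b)))
    (hmina : ∀ Q : PeriodicConfiguration 1, Pa.energyPerParticle lennardJones ≤ Q.energyPerParticle lennardJones)
    (hminb : ∀ Q : PeriodicConfiguration 1, Pb.energyPerParticle lennardJones ≤ Q.energyPerParticle lennardJones) :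
    a = b := by
  obtain ⟨c, hc, -, huniq⟩ := uniquePeriodicMinimiser_lennardJones_one
  -- both chains are translates of `cℤe₀` through `0`; compare the least positive coordinate
  have h0a : (0 : EuclideanSpace ℝ (Fin 1)) ∈ Pa.points := by rw [hPa]; exact ⟨0, by simp⟩
  have h0b : (0 : EuclideanSpace ℝ (Fin 1)) ∈ Pb.points := by rw [hPb]; exact ⟨0, by simp⟩
  have hA := huniq Pa hmina 0 h0a
  have hB := huniq Pb hminb 0 h0b
  simp only [zero_add] at hA hB
  rw [hPa] at hA
  rw [hPb] at hB
  -- the spacing of `{(kc)e₀}` written as `{(ka)e₀}` is `a = c` (a > 0, c > 0): `a e₀ ∈ range ⇒ a = k c`, `c e₀ ∈ range ⇒ c = k' a`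
  have key : ∀ {s : ℝ}, 0 < s →
      Set.range (fun k : ℤ => EuclideanSpace.single (0 : Fin 1) ((k : ℝ) * s)) =
        Set.range (fun k : ℤ => EuclideanSpace.single (0 : Fin 1) ((k : ℝ) * c)) → s = c := by
    intro s hs hsc
    -- `s e₀` is in the right set, `c e₀` in the left set
    have h1 : EuclideanSpace.single (0 : Fin 1) ((1 : ℤ) * s) ∈
        Set.range (fun k : ℤ => EuclideanSpace.single (0 : Fin 1) ((k : ℝ) * c)) := hsc ▸ ⟨1, rfl⟩
    have h2 : EuclideanSpace.single (0 : Fin 1) ((1 : ℤ) * c) ∈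
        Set.range (fun k : ℤ => EuclideanSpace.single (0 : Fin 1) ((k : ℝ) * s)) := hsc.symm ▸ ⟨1, rfl⟩
    obtain ⟨k, hk⟩ := h1
    obtain ⟨k', hk'⟩ := h2
    have e1 : (k : ℝ) * c = s := by
      have := congrArg (fun v : EuclideanSpace ℝ (Fin 1) => v 0) hk
      simpa using this
    have e2 : (k' : ℝ) * s = c := by
      have := congrArg (fun v : EuclideanSpace ℝ (Fin 1) => v 0) hk'
      simpa using this
    -- `k, k' ≥ 1` integers with `k k' = 1`
    have hk1 : (1 : ℝ) ≤ k := by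
      have hkpos : (0 : ℝ) < k := (mul_pos_iff_of_pos_right hc).1 (by rw [e1]; exact hs)
      have h1 : (1 : ℤ) ≤ k := by
        have h0 : (0 : ℤ) < k := by exact_mod_cast hkpos
        omega
      exact_mod_cast h1
    have hk1' : (1 : ℝ) ≤ k' := by
      have hkpos : (0 : ℝ) < k' := (mul_pos_iff_of_pos_right hs).1 (by rw [e2]; exact hc)
      have h1 : (1 : ℤ) ≤ k' := by
        have h0 : (0 : ℤ) < k' := by exact_mod_cast hkpos
        omega
      exact_mod_cast h1
    nlinarith
  exact (key ha hA).trans (key hb hB).symm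

end Summit.AtomisticToContinuum.Crystallization.Theorems.ThreeConeCertificateExactCertificate.Transfer1D

end
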